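import Summits.ABC.ABC.Theses.CubicResolventAllowance
import Literature.NumberTheory.DiophantineGeometry.GenEllThm21With
import Literature.NumberTheory.EllipticCurves.Szpiro
import HarnessLib

/-!
# STUB-IDEAS `stub_realCubic` · ideator k1 (FAMILY 1 — recognise & import) · generation 8 — consolidation

Crux stmt-ABC-22740 `CubicResolventAllowance.IndexSzpiro`, stub `stub_realCubic` (the `0 < d_K` half).
Companion of `STUB-IDEAS-stub_realCubic-1.md` rev 8.  Gens 2–7 of this slot (files `StubIdeas1RealSketch*.lean`
in this directory) settled what the stub IS: `SzpiroConjecture ⟹ StubReal ⟹ abc₁₆ off the binomial cubes 𝓑`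
(G7 R10, kernel-checked modulo the proposals H1–H4⁺ restated below).  Gen 8 adds no new mechanism — the last
two Family-1 imports examined (Langevin's binary-form abc, B–G Thm 12.2.12; the two function-field Szpiro engines,
Kodaira/BMY and Riemann–Hurwitz/Mason) port to abc-complete statements — and only (i) restates the bankable
helper signatures so that ONE file elaborates them against today's tree, (ii) adds N5 `signDoorPos_holds`, which
discharges the `hsign` hypothesis of G7 R6a/R6c/R10 (proof = G5 K7b `discr_neg_iff_Δ_neg` + `discr_ne_zero`,
S-sized once k3's keystone P0 lands under `Theorems/`).  `sorry` = proposal; sizes in the docstrings.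
Nothing here proves the stub (abc-hard, verdict of 3 ideators × 7 gens).
-/

set_option linter.dupNamespace false

noncomputable section

namespace Summit.ABC.ABC.Cruxes.IndexSzpiro.StubIdeasRealCubic1G8

open Polynomial UniqueFactorizationMonoid WeierstrassCurve
open Literature.NumberTheory.EllipticCurves Literature.NumberTheory.DiophantineGeometry

/-- The stub, verbatim (payload `stub.signature`). -/
def StubReal : Prop :=
  ∀ ε : ℝ, 0 < ε → ∃ C : ℝ, ∀ (W : WeierstrassCurve ℚ) [W.IsElliptic] (K : Type) [Field K] [NumberField K],
    Irreducible W.twoTorsionPolynomial.toPoly → Module.finrank ℚ K = 3 →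
    (∃ θ : K, aeval θ W.twoTorsionPolynomial.toPoly = 0) → 0 < NumberField.discr K →
    (W.minimalDiscriminantNorm ℤ : ℝ) ≤ C * |(NumberField.discr K : ℝ)| * (W.conductorNorm ℤ : ℝ) ^ (6 + ε)

/-- R0a (kernel-checked, = G7). The route crux gives the stub. [folklore] -/
theorem stubReal_of_indexSzpiro (h : Summit.ABC.ABC.Theses.CubicResolventAllowance.IndexSzpiro) :
    StubReal := by
  intro ε hε
  obtain ⟨C, hC⟩ := h ε hε
  exact ⟨C, fun W _ K _ _ hirr h3 hθ _ => hC W K hirr h3 hθ⟩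

/-- R0b (kernel-checked, = G7). Szpiro's conjecture gives the stub (`|d_K| ≥ 1`); with the tree's
`szpiro_of_abcLe_holds` / `Summit.ABC.Harvest.szpiro_of_abc` the stub sits BELOW abc. [folklore] -/
theorem stubReal_of_szpiro (h : SzpiroConjecture) : StubReal := by
  intro ε hε
  obtain ⟨C, hC⟩ := h ε hε
  refine ⟨max C 0, fun W _ K _ _ _ _ _ _ => ?_⟩
  have h1 := hC W
  have hN : (0 : ℝ) ≤ (W.conductorNorm ℤ : ℝ) ^ (6 + ε) := by positivity
  have hd : (1 : ℝ) ≤ |(NumberField.discr K : ℝ)| := by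
    have := Int.one_le_abs (NumberField.discr_ne_zero K)
    exact_mod_cast this
  calc (W.minimalDiscriminantNorm ℤ : ℝ) ≤ C * (W.conductorNorm ℤ : ℝ) ^ (6 + ε) := h1
    _ ≤ max C 0 * (W.conductorNorm ℤ : ℝ) ^ (6 + ε) := by gcongr; exact le_max_left _ _
    _ = max C 0 * 1 * (W.conductorNorm ℤ : ℝ) ^ (6 + ε) := by ring
    _ ≤ max C 0 * |(NumberField.discr K : ℝ)| * (W.conductorNorm ℤ : ℝ) ^ (6 + ε) := by
        gcongr

/-! ## N5 — discharge the sign door (NEW in gen 8 as a named target; S) -/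

/-- The sign door, positive direction (G7 `SignDoorPos`, there a HYPOTHESIS of R6a/R6c/R10). [folklore] -/
def SignDoorPos : Prop :=
  ∀ (W : WeierstrassCurve ℚ) [W.IsElliptic] (K : Type) [Field K] [NumberField K],
    Irreducible W.twoTorsionPolynomial.toPoly → Module.finrank ℚ K = 3 →
    (∃ θ : K, aeval θ W.twoTorsionPolynomial.toPoly = 0) → 0 < W.Δ → 0 < NumberField.discr K

/-- **N5 (S).** `SignDoorPos` holds: from the keystone `Δ(W) = q²·d_K` (`q ∈ ℚˣ`; G5 `K6_Δ_eq_sq_mul_discr` /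
`discSqRatio`, k3 `exists_index_sq_eq` — all kernel-checked in `Cruxes/IndexSzpiro/StubIdeas1G5Sketch.lean`)
`0 < Δ` and `0 < q²` give `0 < d_K`.  Five lines once the keystone is importable (k3 P0: land it under
`Theorems/`); until then the proof is G5's K1–K6 chain (≈ 120 lines, `Literature.NumberTheory.NumberFields.CubicFieldExplicit`).
Landing N5 makes G7's calibration `IndexSzpiro → ABCWithExponentOffCubes 16` hypothesis-free. [folklore] -/
theorem signDoorPos_holds : SignDoorPos := by
  sorry

/-! ## The j-line pencil and the bankable helpers H2–H4 (signatures verbatim from G7; proofs proposed there) -/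

/-- The integral j-line pencil `W_{a,b} : Y² = X³ − 27·b(a+b)·X − 54·b²(a+b)` (G7 R1; `Δ = 2⁶3⁹·a·b³·(a+b)²`,
`j = 1728(a+b)/a`). -/
def jPencilInt (a b : ℤ) : WeierstrassCurve ℤ := ⟨0, 0, 0, -27 * b * (a + b), -54 * b ^ 2 * (a + b)⟩

/-- Its base change to `ℚ`. -/
abbrev jPencil (a b : ℤ) : WeierstrassCurve ℚ := (jPencilInt a b).baseChange ℚ

/-- **H2 (S; G7 R4b).** `a ∣ 1728·den(j(W_{a,b}))`: `j = 1728c/a` with `gcd(a,c)=1`. [folklore] -/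
theorem dvd_mul_den_j {a b c : ℕ} (h : IsABCTriple a b c) [(jPencil a b).IsElliptic] :
    a ∣ 1728 * ((jPencil a b).j).den := by
  sorry

/-- **H3 (M; G7 R5).** `N(W_{a,b}) ∣ 2⁸·3⁵·rad(abc)²` (`f₂ ≤ 8`, `f₃ ≤ 5`, `f_p ≤ 2` for `p ≥ 5`, `f_p = 0` off `6abc`;
tree: `conductorNorm_dvd_of_forall_conductorExponent_le`, `conductorExponent_le_eight_holds`,
`conductorExponent_le_five_of_natGenerator_eq_three_holds`, `conductorExponent_le_two_of_five_le_natGenerator_holds`,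
`conductorExponent_eq_zero_of_not_dvd_Δ`). [folklore] -/
theorem conductorNorm_jPencil_dvd {a b c : ℕ} (h : IsABCTriple a b c) [(jPencil a b).IsElliptic] :
    (jPencil a b).conductorNorm ℤ ∣ 2 ^ 8 * 3 ^ 5 * (rad a b c) ^ 2 := by
  sorry

/-- `c` is a cube up to a divisor of `8` (image of the `X₀(2)` locus = the binomial cubes `𝓑`, G7 R2d/R7). -/
def CubeUpToEight (c : ℕ) : Prop := ∃ u g : ℕ, g ∣ 8 ∧ u ^ 3 = g * c

/-- abc with exponent `Λ` off the cube sums (G7): the tree's `GenEll.ABCWithExponent Λ` sentence restricted to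
triples whose `c` is not a cube up to `8`. Open for every `Λ`. -/
def ABCWithExponentOffCubes (Λ : ℝ) : Prop :=
  ∀ ε : ℝ, 0 < ε → ∃ C : ℝ, 0 < C ∧
    ∀ a b c : ℕ, IsABCTriple a b c → ¬ CubeUpToEight c →
      (c : ℝ) < C * ((rad a b c : ℕ) : ℝ) ^ (Λ * (1 + ε))

/-- **H4 (M; G7 R6a with `hsign` discharged by N5).** `stub_realCubic ⟹ abc with exponent 16 off the cube sums`:
role `a = max(a,b) ≥ c/2`; off `𝓑` the 2-division cubic of `W_{a,b}` is irreducible (G7 R2c′) and its field is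
real (N5 + `Δ > 0`); stub + H2 (`a ≤ 1728·Δ_min`, G7 R4a `den_j_dvd_minimalDiscriminantNorm`) + closed support
`ResolventDiscBounds` (`|d_K| ≤ 1944N²`) + H3 (`N ≤ 2⁸3⁵rad²`) give `c ≤ 2a < C'·rad^{16+2ε}`. [folklore] -/
theorem abcOffCubes_sixteen_of_stubReal (h : StubReal) : ABCWithExponentOffCubes 16 := by
  sorry

/-- **H4c (S ∘ H4).** The hypothesis-free calibration of the ROUTE CRUX through its real half. [folklore] -/
theorem abcOffCubes_sixteen_of_indexSzpiro
    (h : Summit.ABC.ABC.Theses.CubicResolventAllowance.IndexSzpiro) : ABCWithExponentOffCubes 16 :=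
  abcOffCubes_sixteen_of_stubReal (stubReal_of_indexSzpiro h)

/-- R10′ — the sandwich by name, now with no side hypothesis (kernel-checked modulo N5/H2/H3/H4). [folklore] -/
theorem stubReal_sandwich :
    (SzpiroConjecture → StubReal) ∧ (StubReal → ABCWithExponentOffCubes 16) :=
  ⟨stubReal_of_szpiro, abcOffCubes_sixteen_of_stubReal⟩

end Summit.ABC.ABC.Cruxes.IndexSzpiro.StubIdeasRealCubic1G8

end
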